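import Summits.RiemannHypothesis.RiemannHypothesis.Theorems.SemilocalNegCertUptoHundredThirtyOneKinkedP
import Summits.RiemannHypothesis.RiemannHypothesis.Theorems.SemilocalNegCertUptoHundredThirtyOneKinkedQ
import Summits.RiemannHypothesis.RiemannHypothesis.Theorems.SemilocalNegCertUptoHundredThirtyOneKinkedR
import Summits.RiemannHypothesis.RiemannHypothesis.Theorems.SemilocalNegCertUptoHundredThirtyOneKinkedS
import Summits.RiemannHypothesis.RiemannHypothesis.Theorems.SemilocalNegCertUptoHundredThirtyOneKinkedU
import Summits.RiemannHypothesis.RiemannHypothesis.Theorems.SemilocalNegCertUptoHundredThirtyOneKinkedV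
import Summits.RiemannHypothesis.RiemannHypothesis.Theorems.SemilocalNegCertUptoHundredThirtyOneKinkedW
import Summits.RiemannHypothesis.RiemannHypothesis.Theorems.SemilocalNegCertUptoHundredThirtyOneKinkedX
import Summits.RiemannHypothesis.RiemannHypothesis.Theorems.SemilocalNegCertUptoHundredThirtyOneKinkedY
import Summits.RiemannHypothesis.RiemannHypothesis.Theorems.SemilocalNegCertUptoHundredThirtyOneKinkedZ
import Summits.RiemannHypothesis.RiemannHypothesis.Theorems.SemilocalNegCertUptoHundredThirtyOneKinkedBa
import HarnessLib

/-!
# Semi-local threshold of the `{∞} ∪ {p < 137}` form, negative side: `a*({2,…,131}) ≤ 1263/512` — the wall `q = 137` from a KINKED (piecewise-cubic) witness (part 12/14: the composition of the piece facts 300 … 436)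

Cell `rh-explicit` (HOME `run/shared/lean/pub/rh-explicit/`), seat cc-s2-4 (A4 SEMILOCAL-TABLE, kernel column; pipeline gen11 `mkkinked.py`).
Honest framing: theorems about the tree's `weilSemilocalThreshold S`; nothing here bears on RH.  No data is trusted: every bound is a
`decide +kernel` fact of the piecewise certificate `SemilocalPiecewiseCert.lean` (cc-s2-4 gen8).

Instance: `S = {p < 137}`, window `b = 1263/512` (last /1024 value below `(log 139)/2`), `N = 138`, 45 atoms; odd piecewise-cubic
witness with 20 slope breaks at the atom images `|b − log n|` nearest `0` (atoms `n = 11, 13, 9, 16, 17, 8, 19, 7, 23, 25, 27, 5, 29, 31, 32, 4, 37, 41, 43, 3`,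
rounded to `/1024`); float finder `Re Q/‖G‖² = -2.626e-04` (no polar credit); orders `(10, 4, 8, 4, 10, 40)`, 437 `t`-pieces
(far widths ≤ 1/4); exact kernel margin `(rhs − lhs)/‖G‖² = 2.6311e-04`.  ⇒ **`a*({p < 137}) ≤ 1263/512 < (log 139)/2`**.
The instance is split for the gate into part 1
(table, certificate, `checkMainPW`, the atom side in kernel chunks of ≤ 4 atoms via `SemilocalPiecewiseCertSplit.lean`), parts 2–8
(68 piece facts each in the FLEX layout of `SemilocalPiecewiseCertFlex.lean` (cc-s2-4 gen12, CC4-LEAN §17.2): piece `0` by `checkPiecePW`,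
every far piece by `checkPieceFlex i ⟨n, m, K, m', u₀⟩` with the orders that piece needs (mean majorant degree ≈ 62 instead of 176) and a
short dyadic centre `u₀ ≤ u_K(T₀)` — same witness, same cuts, claims recomputed (`⌈exact⌉ + 1`), kernel margin `2.6309e-04`·‖G‖²; each
fact file imports part 1 only), the Pieces part (composition) and the Final part (theorems).  Folklore throughout.
-/

set_option autoImplicit false
set_option linter.dupNamespace false  -- the mandated namespace repeats `RiemannHypothesis`
set_option Elab.async false  -- serialise the kernel facts: in parallel they exhaust the node's per-process heap (cc-s2-4 gen11, CC4-LEAN §16.10)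

noncomputable section

open Complex Filter Set MeasureTheory Topology
open scoped Real

namespace Summit.RiemannHypothesis.RiemannHypothesis.Theorems.SemilocalPolyWitness

open MeasureTheory Set Finset Real
open Literature.NumberTheory.LFunctions
open Summit.RiemannHypothesis.RiemannHypothesis.Theorems.MotivicDoor
open Summit.RiemannHypothesis.RiemannHypothesis.Theorems.MotivicDoor.SemilocalThreshold
open Summit.RiemannHypothesis.RiemannHypothesis.Theorems.MotivicDoor.SemilocalMarkov
open LQ

/-- pieces `300 ≤ i < 437` of `certUptoHundredThirtyOneKinked` check (FLEX form). -/
theorem check_UptoHundredThirtyOneKinked_pieces_3 : ∀ i, 300 ≤ i → i < 437 →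
    certUptoHundredThirtyOneKinked.checkPiecePW i = true ∨ ∃ o, certUptoHundredThirtyOneKinked.checkPieceFlex i o = true := by
  intro i hlo hhi
  interval_cases i
  · exact Or.inr ⟨_, check_UptoHundredThirtyOneKinked_piece300⟩
  · exact Or.inr ⟨_, check_UptoHundredThirtyOneKinked_piece301⟩
  · exact Or.inr ⟨_, check_UptoHundredThirtyOneKinked_piece302⟩
  · exact Or.inr ⟨_, check_UptoHundredThirtyOneKinked_piece303⟩
  · exact Or.inr ⟨_, check_UptoHundredThirtyOneKinked_piece304⟩
  · exact Or.inr ⟨_, check_UptoHundredThirtyOneKinked_piece305⟩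
  · exact Or.inr ⟨_, check_UptoHundredThirtyOneKinked_piece306⟩
  · exact Or.inr ⟨_, check_UptoHundredThirtyOneKinked_piece307⟩
  · exact Or.inr ⟨_, check_UptoHundredThirtyOneKinked_piece308⟩
  · exact Or.inr ⟨_, check_UptoHundredThirtyOneKinked_piece309⟩
  · exact Or.inr ⟨_, check_UptoHundredThirtyOneKinked_piece310⟩
  · exact Or.inr ⟨_, check_UptoHundredThirtyOneKinked_piece311⟩
  · exact Or.inr ⟨_, check_UptoHundredThirtyOneKinked_piece312⟩
  · exact Or.inr ⟨_, check_UptoHundredThirtyOneKinked_piece313⟩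
  · exact Or.inr ⟨_, check_UptoHundredThirtyOneKinked_piece314⟩
  · exact Or.inr ⟨_, check_UptoHundredThirtyOneKinked_piece315⟩
  · exact Or.inr ⟨_, check_UptoHundredThirtyOneKinked_piece316⟩
  · exact Or.inr ⟨_, check_UptoHundredThirtyOneKinked_piece317⟩
  · exact Or.inr ⟨_, check_UptoHundredThirtyOneKinked_piece318⟩
  · exact Or.inr ⟨_, check_UptoHundredThirtyOneKinked_piece319⟩
  · exact Or.inr ⟨_, check_UptoHundredThirtyOneKinked_piece320⟩
  · exact Or.inr ⟨_, check_UptoHundredThirtyOneKinked_piece321⟩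
  · exact Or.inr ⟨_, check_UptoHundredThirtyOneKinked_piece322⟩
  · exact Or.inr ⟨_, check_UptoHundredThirtyOneKinked_piece323⟩
  · exact Or.inr ⟨_, check_UptoHundredThirtyOneKinked_piece324⟩
  · exact Or.inr ⟨_, check_UptoHundredThirtyOneKinked_piece325⟩
  · exact Or.inr ⟨_, check_UptoHundredThirtyOneKinked_piece326⟩
  · exact Or.inr ⟨_, check_UptoHundredThirtyOneKinked_piece327⟩
  · exact Or.inr ⟨_, check_UptoHundredThirtyOneKinked_piece328⟩
  · exact Or.inr ⟨_, check_UptoHundredThirtyOneKinked_piece329⟩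
  · exact Or.inr ⟨_, check_UptoHundredThirtyOneKinked_piece330⟩
  · exact Or.inr ⟨_, check_UptoHundredThirtyOneKinked_piece331⟩
  · exact Or.inr ⟨_, check_UptoHundredThirtyOneKinked_piece332⟩
  · exact Or.inr ⟨_, check_UptoHundredThirtyOneKinked_piece333⟩
  · exact Or.inr ⟨_, check_UptoHundredThirtyOneKinked_piece334⟩
  · exact Or.inr ⟨_, check_UptoHundredThirtyOneKinked_piece335⟩
  · exact Or.inr ⟨_, check_UptoHundredThirtyOneKinked_piece336⟩
  · exact Or.inr ⟨_, check_UptoHundredThirtyOneKinked_piece337⟩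
  · exact Or.inr ⟨_, check_UptoHundredThirtyOneKinked_piece338⟩
  · exact Or.inr ⟨_, check_UptoHundredThirtyOneKinked_piece339⟩
  · exact Or.inr ⟨_, check_UptoHundredThirtyOneKinked_piece340⟩
  · exact Or.inr ⟨_, check_UptoHundredThirtyOneKinked_piece341⟩
  · exact Or.inr ⟨_, check_UptoHundredThirtyOneKinked_piece342⟩
  · exact Or.inr ⟨_, check_UptoHundredThirtyOneKinked_piece343⟩
  · exact Or.inr ⟨_, check_UptoHundredThirtyOneKinked_piece344⟩
  · exact Or.inr ⟨_, check_UptoHundredThirtyOneKinked_piece345⟩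
  · exact Or.inr ⟨_, check_UptoHundredThirtyOneKinked_piece346⟩
  · exact Or.inr ⟨_, check_UptoHundredThirtyOneKinked_piece347⟩
  · exact Or.inr ⟨_, check_UptoHundredThirtyOneKinked_piece348⟩
  · exact Or.inr ⟨_, check_UptoHundredThirtyOneKinked_piece349⟩
  · exact Or.inr ⟨_, check_UptoHundredThirtyOneKinked_piece350⟩
  · exact Or.inr ⟨_, check_UptoHundredThirtyOneKinked_piece351⟩
  · exact Or.inr ⟨_, check_UptoHundredThirtyOneKinked_piece352⟩
  · exact Or.inr ⟨_, check_UptoHundredThirtyOneKinked_piece353⟩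
  · exact Or.inr ⟨_, check_UptoHundredThirtyOneKinked_piece354⟩
  · exact Or.inr ⟨_, check_UptoHundredThirtyOneKinked_piece355⟩
  · exact Or.inr ⟨_, check_UptoHundredThirtyOneKinked_piece356⟩
  · exact Or.inr ⟨_, check_UptoHundredThirtyOneKinked_piece357⟩
  · exact Or.inr ⟨_, check_UptoHundredThirtyOneKinked_piece358⟩
  · exact Or.inr ⟨_, check_UptoHundredThirtyOneKinked_piece359⟩
  · exact Or.inr ⟨_, check_UptoHundredThirtyOneKinked_piece360⟩
  · exact Or.inr ⟨_, check_UptoHundredThirtyOneKinked_piece361⟩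
  · exact Or.inr ⟨_, check_UptoHundredThirtyOneKinked_piece362⟩
  · exact Or.inr ⟨_, check_UptoHundredThirtyOneKinked_piece363⟩
  · exact Or.inr ⟨_, check_UptoHundredThirtyOneKinked_piece364⟩
  · exact Or.inr ⟨_, check_UptoHundredThirtyOneKinked_piece365⟩
  · exact Or.inr ⟨_, check_UptoHundredThirtyOneKinked_piece366⟩
  · exact Or.inr ⟨_, check_UptoHundredThirtyOneKinked_piece367⟩
  · exact Or.inr ⟨_, check_UptoHundredThirtyOneKinked_piece368⟩
  · exact Or.inr ⟨_, check_UptoHundredThirtyOneKinked_piece369⟩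
  · exact Or.inr ⟨_, check_UptoHundredThirtyOneKinked_piece370⟩
  · exact Or.inr ⟨_, check_UptoHundredThirtyOneKinked_piece371⟩
  · exact Or.inr ⟨_, check_UptoHundredThirtyOneKinked_piece372⟩
  · exact Or.inr ⟨_, check_UptoHundredThirtyOneKinked_piece373⟩
  · exact Or.inr ⟨_, check_UptoHundredThirtyOneKinked_piece374⟩
  · exact Or.inr ⟨_, check_UptoHundredThirtyOneKinked_piece375⟩
  · exact Or.inr ⟨_, check_UptoHundredThirtyOneKinked_piece376⟩
  · exact Or.inr ⟨_, check_UptoHundredThirtyOneKinked_piece377⟩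
  · exact Or.inr ⟨_, check_UptoHundredThirtyOneKinked_piece378⟩
  · exact Or.inr ⟨_, check_UptoHundredThirtyOneKinked_piece379⟩
  · exact Or.inr ⟨_, check_UptoHundredThirtyOneKinked_piece380⟩
  · exact Or.inr ⟨_, check_UptoHundredThirtyOneKinked_piece381⟩
  · exact Or.inr ⟨_, check_UptoHundredThirtyOneKinked_piece382⟩
  · exact Or.inr ⟨_, check_UptoHundredThirtyOneKinked_piece383⟩
  · exact Or.inr ⟨_, check_UptoHundredThirtyOneKinked_piece384⟩
  · exact Or.inr ⟨_, check_UptoHundredThirtyOneKinked_piece385⟩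
  · exact Or.inr ⟨_, check_UptoHundredThirtyOneKinked_piece386⟩
  · exact Or.inr ⟨_, check_UptoHundredThirtyOneKinked_piece387⟩
  · exact Or.inr ⟨_, check_UptoHundredThirtyOneKinked_piece388⟩
  · exact Or.inr ⟨_, check_UptoHundredThirtyOneKinked_piece389⟩
  · exact Or.inr ⟨_, check_UptoHundredThirtyOneKinked_piece390⟩
  · exact Or.inr ⟨_, check_UptoHundredThirtyOneKinked_piece391⟩
  · exact Or.inr ⟨_, check_UptoHundredThirtyOneKinked_piece392⟩
  · exact Or.inr ⟨_, check_UptoHundredThirtyOneKinked_piece393⟩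
  · exact Or.inr ⟨_, check_UptoHundredThirtyOneKinked_piece394⟩
  · exact Or.inr ⟨_, check_UptoHundredThirtyOneKinked_piece395⟩
  · exact Or.inr ⟨_, check_UptoHundredThirtyOneKinked_piece396⟩
  · exact Or.inr ⟨_, check_UptoHundredThirtyOneKinked_piece397⟩
  · exact Or.inr ⟨_, check_UptoHundredThirtyOneKinked_piece398⟩
  · exact Or.inr ⟨_, check_UptoHundredThirtyOneKinked_piece399⟩
  · exact Or.inr ⟨_, check_UptoHundredThirtyOneKinked_piece400⟩
  · exact Or.inr ⟨_, check_UptoHundredThirtyOneKinked_piece401⟩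
  · exact Or.inr ⟨_, check_UptoHundredThirtyOneKinked_piece402⟩
  · exact Or.inr ⟨_, check_UptoHundredThirtyOneKinked_piece403⟩
  · exact Or.inr ⟨_, check_UptoHundredThirtyOneKinked_piece404⟩
  · exact Or.inr ⟨_, check_UptoHundredThirtyOneKinked_piece405⟩
  · exact Or.inr ⟨_, check_UptoHundredThirtyOneKinked_piece406⟩
  · exact Or.inr ⟨_, check_UptoHundredThirtyOneKinked_piece407⟩
  · exact Or.inr ⟨_, check_UptoHundredThirtyOneKinked_piece408⟩
  · exact Or.inr ⟨_, check_UptoHundredThirtyOneKinked_piece409⟩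
  · exact Or.inr ⟨_, check_UptoHundredThirtyOneKinked_piece410⟩
  · exact Or.inr ⟨_, check_UptoHundredThirtyOneKinked_piece411⟩
  · exact Or.inr ⟨_, check_UptoHundredThirtyOneKinked_piece412⟩
  · exact Or.inr ⟨_, check_UptoHundredThirtyOneKinked_piece413⟩
  · exact Or.inr ⟨_, check_UptoHundredThirtyOneKinked_piece414⟩
  · exact Or.inr ⟨_, check_UptoHundredThirtyOneKinked_piece415⟩
  · exact Or.inr ⟨_, check_UptoHundredThirtyOneKinked_piece416⟩
  · exact Or.inr ⟨_, check_UptoHundredThirtyOneKinked_piece417⟩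
  · exact Or.inr ⟨_, check_UptoHundredThirtyOneKinked_piece418⟩
  · exact Or.inr ⟨_, check_UptoHundredThirtyOneKinked_piece419⟩
  · exact Or.inr ⟨_, check_UptoHundredThirtyOneKinked_piece420⟩
  · exact Or.inr ⟨_, check_UptoHundredThirtyOneKinked_piece421⟩
  · exact Or.inr ⟨_, check_UptoHundredThirtyOneKinked_piece422⟩
  · exact Or.inr ⟨_, check_UptoHundredThirtyOneKinked_piece423⟩
  · exact Or.inr ⟨_, check_UptoHundredThirtyOneKinked_piece424⟩
  · exact Or.inr ⟨_, check_UptoHundredThirtyOneKinked_piece425⟩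
  · exact Or.inr ⟨_, check_UptoHundredThirtyOneKinked_piece426⟩
  · exact Or.inr ⟨_, check_UptoHundredThirtyOneKinked_piece427⟩
  · exact Or.inr ⟨_, check_UptoHundredThirtyOneKinked_piece428⟩
  · exact Or.inr ⟨_, check_UptoHundredThirtyOneKinked_piece429⟩
  · exact Or.inr ⟨_, check_UptoHundredThirtyOneKinked_piece430⟩
  · exact Or.inr ⟨_, check_UptoHundredThirtyOneKinked_piece431⟩
  · exact Or.inr ⟨_, check_UptoHundredThirtyOneKinked_piece432⟩
  · exact Or.inr ⟨_, check_UptoHundredThirtyOneKinked_piece433⟩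
  · exact Or.inr ⟨_, check_UptoHundredThirtyOneKinked_piece434⟩
  · exact Or.inr ⟨_, check_UptoHundredThirtyOneKinked_piece435⟩
  · exact Or.inr ⟨_, check_UptoHundredThirtyOneKinked_piece436⟩

end Summit.RiemannHypothesis.RiemannHypothesis.Theorems.SemilocalPolyWitness

end
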